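import Literature.AnabelianGeometry.SemiGraphs.ProSigmaCompletionProfiniteExtend
import Literature.AnabelianGeometry.SemiGraphs.SurfaceTypeMixedBranchQuotients
import Mathlib.GroupTheory.Archimedean
import Mathlib.Data.ZMod.QuotientGroup
import HarnessLib

/-!
# The edge groups of a semi-graph of anabelioids of surface type are pro-`Σ` completions of `ℤ`
([SemiAnbd] Example 2.10)

Mochizuki, *Semi-graphs of anabelioids*, Publ. RIMS **42** (2006) 221–322, Example 2.10 p. 31
[cite: MochizukiSemiAnbd2006, Ex. 2.10 p.31]: for a semi-graph of anabelioids of surface type "each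
`Π_b → Π_v` is the inclusion morphism of the inertia group of one of the cusps" of "the maximal pro-`Σ`
quotient of the fundamental group of a hyperbolic Riemann surface of finite type" — the inertia group of
a cusp of the pro-`Σ` fundamental group being the closure `Ī_j` of the image of the discrete inertia
group `⟨c_j⟩ ≅ ℤ` of `Γ_{g,r}`, a copy of `Ẑ^Σ`.  In the tree's interface (`IsProSigmaCompletion Σ ι`,
`Coverticial.lean`; branch groups `closure ι(⟨c_j⟩)` in `IsOfSurfaceType`) this file PROVES:

* `PuncturedSurfaceGroup.zpow_c_injective` — for hyperbolic `(g, r)` the powers of a cusp generator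
  `c_j` of `Γ_{g,r}` are pairwise distinct (`not_isOfFinOrder_c` of `SurfaceTypeMixedBranchQuotients`);
* `isSigmaInteger_index_of_isOpen_of_subgroup` — for a pro-`Σ` completion `ι : Γ → P` (`P`
  profinite) and ANY subgroup `H ⊆ P`, open subgroups of `H` have `Σ`-integer index in `H`;
* `isProSigmaCompletion_cuspInertiaClosure` — **`Ī_j` is the pro-`Σ` completion of `ℤ`**: the map
  `ℤ → Ī_j = closure ι(⟨c_j⟩)`, `m ↦ ι(c_j)^m`, satisfies `IsProSigmaCompletion Σ` (dense image; open
  subgroups of `Σ`-index; the subgroup `nℤ`, `n` a `Σ`-integer, is cut out by an open subgroup of `P`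
  meeting every closed cusp inertia group in its `n`-th powers — `exists_normal_inf_cuspInertia_eq` +
  universality of `ι`);
* `exists_continuousMulEquiv_cuspInertiaClosure` — hence ANY two closed cusp inertia groups, of any two
  pro-`Σ` completions of any two hyperbolic punctured surface groups, are isomorphic as topological
  groups by an isomorphism matching the images of the cusp generators (uniqueness of pro-`Σ`
  completions, `IsProSigmaCompletion.exists_continuousMulEquiv`): "`Π_e ≅ Ẑ^Σ`" independently of the
  vertex — the input for gluing vertex groups of different types along a node.

Plain (pro)finite group theory; nothing here takes a side on [IUTchIII] Cor. 3.12.  Theorems only.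
-/

namespace Literature.GroupTheory.CombinatorialGroupTheory.PuncturedSurfaceGroup

variable {g r : ℕ}

/-- For hyperbolic `(g, r)`, `m ↦ c_j ^ m` (`m ∈ ℤ`) is injective: the cusp generators have infinite
order (`not_isOfFinOrder_c`, `SurfaceTypeMixedBranchQuotients.lean`). [cite: MochizukiSemiAnbd2006, Ex. 2.10 p.31] -/
theorem zpow_c_injective (h : IsHyperbolicType g r) (j : Fin r) :
    Function.Injective fun m : ℤ => (c j : PuncturedSurfaceGroup g r) ^ m :=
  injective_zpow_iff_not_isOfFinOrder.mpr (not_isOfFinOrder_c h j)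

/-- `c_j ^ m ∈ ⟨c_j ^ n⟩` iff `n ∣ m`. [cite: MochizukiSemiAnbd2006, Ex. 2.10 p.31] -/
theorem zpow_c_mem_zpowers_pow_iff (h : IsHyperbolicType g r) (j : Fin r) (n : ℕ) (m : ℤ) :
    (c j : PuncturedSurfaceGroup g r) ^ m ∈ Subgroup.zpowers (c j ^ n) ↔ (n : ℤ) ∣ m := by
  constructor
  · rintro ⟨k, hk⟩
    refine ⟨k, zpow_c_injective h j ?_⟩
    dsimp only at hk ⊢
    rw [← hk, ← zpow_natCast, ← zpow_mul, mul_comm]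
  · rintro ⟨k, rfl⟩
    exact ⟨k, by dsimp only; rw [← zpow_natCast, ← zpow_mul, mul_comm]⟩

end Literature.GroupTheory.CombinatorialGroupTheory.PuncturedSurfaceGroup

namespace Literature.AnabelianGeometry.SemiGraphs.SemiGraphOfAnabelioids.IsProSigmaCompletion

open Literature.AnabelianGeometry.Anabelioids Topology
open Literature.GroupTheory.CombinatorialGroupTheory
open Literature.GroupTheory.CombinatorialGroupTheory.PuncturedSurfaceGroup

/-! ### Open subgroups of an arbitrary subgroup of a pro-`Σ` completion have `Σ`-integer index -/

section AnySubgroup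

variable {Sigma : Set ℕ} {Γ : Type*} [Group Γ] {P : Type*} [Group P] [TopologicalSpace P]
  [IsTopologicalGroup P] [CompactSpace P] [TotallyDisconnectedSpace P] {ι : Γ →* P}

/-- **Pro-`Σ`-ness passes to all subgroups.**  For `P` the (profinite) pro-`Σ` completion of `Γ` and
ANY subgroup `H ⊆ P`, every open subgroup `N` of `H` (subspace topology) has `Σ`-integer index in `H`:
`N ⊇ H ∩ U` for some open normal `U ⊴ P`, and `[H : H ∩ U] = [HU : U]` divides the `Σ`-integer
`[P : U]`. [cite: MochizukiSemiAnbd2006, Ex. 2.10 p.31] -/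
theorem isSigmaInteger_index_of_isOpen_of_subgroup (hι : IsProSigmaCompletion Sigma ι)
    (H : Subgroup P) (N : Subgroup H) (hN : IsOpen (N : Set H)) :
    IsSigmaInteger Sigma N.index := by
  obtain ⟨O, hO, hON⟩ := isOpen_induced_iff.mp hN
  have h1 : (1 : P) ∈ O := by
    have : (1 : H) ∈ ((↑) ⁻¹' O : Set H) := by rw [hON]; exact N.one_mem
    exact this
  obtain ⟨U, hU⟩ := ProfiniteGrp.exist_openNormalSubgroup_sub_open_nhds_of_one hO h1
  -- `H ∩ U ⊆ N`
  have hle : (U : Subgroup P).comap H.subtype ≤ N := by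
    intro x hx
    have : x ∈ ((↑) ⁻¹' O : Set H) := hU hx
    rw [hON] at this
    exact this
  refine IsSigmaInteger.of_dvd ?_ (Subgroup.index_dvd_of_le hle)
  rw [Subgroup.index_comap, Subgroup.range_subtype]
  exact (hι.index_open U U.isNormal' U.isOpen').of_dvd (Subgroup.relIndex_dvd_index_of_normal _ _)

end AnySubgroup

/-! ### The closed cusp inertia groups are pro-`Σ` completions of `ℤ` -/

section Cusp

variable {Sigma : Set ℕ} {g r : ℕ} {P : Type*} [Group P] [TopologicalSpace P]
  [IsTopologicalGroup P] [CompactSpace P] [TotallyDisconnectedSpace P]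
  {ι : PuncturedSurfaceGroup g r →* P}

omit [CompactSpace P] [TotallyDisconnectedSpace P] in
/-- Powers of `ι(c_j)` lie in the closed cusp inertia group `Ī_j = closure ι(⟨c_j⟩)`.
[cite: MochizukiSemiAnbd2006, Ex. 2.10 p.31] -/
theorem zpowersHom_mem_cuspInertiaClosure (ι : PuncturedSurfaceGroup g r →* P) (j : Fin r)
    (m : Multiplicative ℤ) :
    zpowersHom P (ι (c j)) m ∈ ((cuspInertia (g := g) j).map ι).topologicalClosure :=
  Subgroup.le_topologicalClosure _
    ⟨c j ^ m.toAdd, ⟨m.toAdd, rfl⟩, by rw [zpowersHom_apply, map_zpow]⟩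

/-- **`Π_e ≅ Ẑ^Σ`: the closed cusp inertia group is the pro-`Σ` completion of `ℤ`.**  For a pro-`Σ`
completion `ι : Γ_{g,r} → P` of a hyperbolic punctured surface group (`P` profinite) and a cusp `j`,
the homomorphism `ℤ → Ī_j := closure ι(⟨c_j⟩)`, `m ↦ ι(c_j)^m`, exhibits `Ī_j` as the pro-`Σ`
completion of `ℤ`: its image `ι(⟨c_j⟩)` is dense; open subgroups of `Ī_j` have `Σ`-integer index
(`isSigmaInteger_index_of_isOpen_of_subgroup`); and for a `Σ`-integer `n` the subgroup `nℤ` is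
`ι⁻¹` of the open subgroup `W ∩ Ī_j`, `W ⊆ P` open with `ι⁻¹(W) ∩ ⟨c_j⟩ = ⟨c_j^n⟩`
(`exists_normal_inf_cuspInertia_eq`, universality of `ι`, infinite order of `c_j`).
[cite: MochizukiSemiAnbd2006, Ex. 2.10 p.31] -/
theorem isProSigmaCompletion_cuspInertiaClosure (hι : IsProSigmaCompletion Sigma ι)
    (h : IsHyperbolicType g r) (j : Fin r) :
    IsProSigmaCompletion Sigma ((zpowersHom P (ι (c j))).codRestrict
      ((cuspInertia (g := g) j).map ι).topologicalClosure (zpowersHom_mem_cuspInertiaClosure ι j)) := by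
  set K : Subgroup P := ((cuspInertia (g := g) j).map ι).topologicalClosure with hK
  refine ⟨?_, ?_, ?_⟩
  · -- dense image: `ι(⟨c_j⟩)` is dense in its closure
    intro x
    rw [IsInducing.subtypeVal.closure_eq_preimage_closure_image, Set.mem_preimage]
    have hx : (x : P) ∈ closure (((cuspInertia (g := g) j).map ι : Subgroup P) : Set P) := x.2
    refine closure_mono ?_ hx
    rintro _ ⟨_, ⟨m, rfl⟩, rfl⟩
    refine ⟨⟨ι (c j ^ m), Subgroup.le_topologicalClosure _ ⟨c j ^ m, ⟨m, rfl⟩, rfl⟩⟩,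
      ⟨Multiplicative.ofAdd m, ?_⟩, rfl⟩
    apply Subtype.ext
    change zpowersHom P (ι (c j)) (Multiplicative.ofAdd m) = ι (c j ^ m)
    rw [zpowersHom_apply, map_zpow]
    rfl
  · -- open normal subgroups have `Σ`-integer index
    intro N _ hN
    exact isSigmaInteger_index_of_isOpen_of_subgroup hι K N hN
  · -- universality: `nℤ` is cut out by an open subgroup
    intro N hNn hN
    -- `N = nℤ` with `n = [ℤ : N]`
    set n : ℕ := N.index with hn
    have hn0 : 0 < n := hN.1
    have hmemN : ∀ m : ℤ, Multiplicative.ofAdd m ∈ N ↔ (n : ℤ) ∣ m := by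
      obtain ⟨a, ha⟩ := Int.subgroup_cyclic (Subgroup.toAddSubgroup' N)
      have hidx : (AddSubgroup.zmultiples a).index = n := by
        rw [AddSubgroup.zmultiples_eq_closure, ← ha]
        exact (AddSubgroup.index_toSubgroup (Subgroup.toAddSubgroup' N)).symm.trans
          (congrArg Subgroup.index (OrderIso.apply_symm_apply AddSubgroup.toSubgroup N))
      rw [Int.index_zmultiples] at hidx
      intro m
      rw [← Subgroup.mem_toAddSubgroup', ha, ← AddSubgroup.zmultiples_eq_closure,
        Int.mem_zmultiples_iff, ← hidx, Int.natAbs_dvd]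
    -- a normal subgroup `M ⊴ Γ_{g,r}` of `Σ`-index meeting every `⟨c_j⟩` in `⟨c_j ^ n⟩`
    obtain ⟨M, hMn, hMidx, hMcusp⟩ := exists_normal_inf_cuspInertia_eq (g := g) h hn0
    haveI := hMn
    have hMσ : IsSigmaInteger Sigma M.index := by
      haveI : M.FiniteIndex := ⟨fun h0 => by
        rw [h0] at hMidx
        exact (pow_ne_zero 3 hn0.ne') (Nat.eq_zero_of_zero_dvd hMidx)⟩
      exact ((hN.mul hN).mul hN).of_dvd (by simpa [pow_succ] using hMidx)
    obtain ⟨W, hWo, hW⟩ := hι.comap_surj M hMn hMσ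
    refine ⟨W.comap K.subtype, ?_, ?_⟩
    · exact hWo.preimage continuous_subtype_val
    · ext m
      obtain ⟨m, rfl⟩ := Multiplicative.ofAdd.surjective m
      rw [Subgroup.mem_comap, Subgroup.mem_comap, hmemN]
      change zpowersHom P (ι (c j)) (Multiplicative.ofAdd m) ∈ W ↔ _
      rw [zpowersHom_apply, ← map_zpow, ← Subgroup.mem_comap, hW]
      change c j ^ m ∈ M ↔ _
      rw [← zpow_c_mem_zpowers_pow_iff h j n m, ← hMcusp j, Subgroup.mem_inf]
      exact ⟨fun hm => ⟨hm, m, rfl⟩, fun hm => hm.1⟩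

/-- **Any two closed cusp inertia groups are isomorphic, compatibly with the cusp generators**: for
pro-`Σ` completions `ι : Γ_{g,r} → P`, `ι' : Γ_{g',r'} → P'` of hyperbolic punctured surface groups
(`P`, `P'` profinite) and cusps `j`, `j'`, there is an isomorphism of topological groups
`Ī_j ≅ Ī'_{j'}` carrying `ι(c_j)` to `ι'(c_{j'})` — both are pro-`Σ` completions of `ℤ`
(`isProSigmaCompletion_cuspInertiaClosure` + `exists_continuousMulEquiv`).
[cite: MochizukiSemiAnbd2006, Ex. 2.10 p.31] -/
theorem exists_continuousMulEquiv_cuspInertiaClosure (hι : IsProSigmaCompletion Sigma ι)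
    (h : IsHyperbolicType g r) (j : Fin r) {g' r' : ℕ} {P' : Type*} [Group P'] [TopologicalSpace P']
    [IsTopologicalGroup P'] [CompactSpace P'] [TotallyDisconnectedSpace P']
    {ι' : PuncturedSurfaceGroup g' r' →* P'} (hι' : IsProSigmaCompletion Sigma ι')
    (h' : IsHyperbolicType g' r') (j' : Fin r') :
    ∃ e : ↥((cuspInertia (g := g) j).map ι).topologicalClosure ≃ₜ*
        ↥((cuspInertia (g := g') j').map ι').topologicalClosure,
      ∀ m : ℤ, (e ⟨ι (c j) ^ m, zpowersHom_mem_cuspInertiaClosure ι j (Multiplicative.ofAdd m)⟩ : P') =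
        ι' (c j') ^ m := by
  haveI : CompactSpace ↥((cuspInertia (g := g) j).map ι).topologicalClosure :=
    isCompact_iff_compactSpace.mp (Subgroup.isClosed_topologicalClosure _).isCompact
  haveI : CompactSpace ↥((cuspInertia (g := g') j').map ι').topologicalClosure :=
    isCompact_iff_compactSpace.mp (Subgroup.isClosed_topologicalClosure _).isCompact
  obtain ⟨e, he⟩ := (isProSigmaCompletion_cuspInertiaClosure hι h j).exists_continuousMulEquiv
    (isProSigmaCompletion_cuspInertiaClosure hι' h' j')
  refine ⟨e, fun m => ?_⟩
  change ((e (((zpowersHom P (ι (c j))).codRestrict _ (zpowersHom_mem_cuspInertiaClosure ι j))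
    (Multiplicative.ofAdd m)) : ↥((cuspInertia (g := g') j').map ι').topologicalClosure) : P') = _
  rw [he]
  rfl

end Cusp

end Literature.AnabelianGeometry.SemiGraphs.SemiGraphOfAnabelioids.IsProSigmaCompletion
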